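import Literature.Analysis.OperatorTheory.Enflo2023.Lemma1Lever
import Literature.Analysis.OperatorTheory.Enflo2023.Lemma1Standing
import Literature.Analysis.OperatorTheory.Enflo2023.CaseIICyclic
import HarnessLib

/-!
# Enflo (2023), Lemma 1 with `u₀, u₁, x₀, y₀'` CYCLIC and `(εθ)₀ ≪ δ_k`: the printed choice of `u₁` still fails

P. H. Enflo, *On the invariant subspace problem in Hilbert spaces*, arXiv:2305.15442v2, p. 1, pp. 6–9 and p. 20.

**What this file adds to `Lemma1Model` / `Lemma1Standing` / `Lemma1Regime`.**  Every earlier counter-model to the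
printed Lemma 1 takes `u₀ = e₀` with `span{e₀}` or `span{e₀, e₁}` REDUCING `T`, so `u₀`, `x₀ = (√3/2)u₀ + ½u₁` and
`y₀' = (√3/2)u₀` are NON-CYCLIC — whereas in the manuscript the vectors the construction runs on are cyclic (a
non-cyclic `y` or `ℓ'(T)y'` is an invariant subspace outright: p. 1, and p. 4 after (9), "if εθ = 0 then ℓ'(T)y' is
non-cyclic. Thus, we assume εθ > 0").  `Lemma1Regime` moreover lets `T = T_μ` depend on `(εθ)₀`.  Here BOTH residual
caveats are removed at once, inside the manuscript's regime `(εθ)₀ ≪ δ_k` (p. 8: the `(εθ)`'s "will be of a smaller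
order of magnitude than the `(δ_k)`'s in the definition of type 1"; p. 20: "`δ₁, δ₂`, and `n₀` being independent of
`εθ`"): ONE operator, the compact diagonal `T = D_c = diag(10⁻²⁰/(k+1))_{k ≥ 0}` on `ℓ²(ℕ)` of `CaseIICyclic`
(standing form of v2 p. 1: `‖T‖ = 10⁻²⁰`, injective, dense non-closed range, `0 ∈ σ(T)`; self-adjoint), Type-1
constants `δ_n = 10⁻²⁰ⁿ/(4·10⁴)` FIXED, and for EVERY `(εθ)₀ ∈ (0, 5·10⁻²³]` an orthonormal pair `u₀, u₁` with
`u₀`, `u₁`, `x₀`, `y₀'` ALL CYCLIC for `T`, `T` of Type 1 via `u₀` with those `δ_n`, the printed requirement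
`‖T*u₁‖ < (εθ)₀` (p. 7) in force, and the printed conclusion of Lemma 1 (p. 9: `εθ(ℓ'_ε) ≤ ½·10⁻⁵(εθ)₀` for some
`ε ∈ (½ − 10⁻⁵(εθ)₀, ½]`) FALSE at every radius of the window (`printed_lemma1_fails_cyclic`; instance
`printed_lemma1_fails_cyclic_instance`, `(εθ)₀ = 10⁻⁶⁰ ≪ δ₂ = 2.5·10⁻⁴⁵ ≪ δ₁ = 2.5·10⁻²⁵`).

**The construction** (`q = 10⁻²⁰ = lam`, `w_k = q/(k+1) = wgt k`; parameter `a = (εθ)₀/(2q) ∈ (0, 1/400]`,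
`K = ⌈1/a²⌉` (`Kof`), so `1/(K+1) ≤ a²`).  Profile `p₀ = 1`, `p_k = a³2⁻ᵏ` (`1 ≤ k < K`), `p_k = a·2^{-(k−K)}`
(`k ≥ K`) (`pz`), `z = (p_k)_k ∈ ℓ²` (`zv`): a unit head at `e₀`, a FAR geometric block of mass `(4/3)a²` sitting
where `w_k ≤ qa²`, and a tiny filler `a³2⁻ᵏ` in between whose only job is to make every coordinate non-zero.
Put `x̄ = ⟨z, Tz⟩/‖z‖²` (`xbar`), `g = Tz − x̄z` (`gv`, so `g ⟂ z`, `inner_zv_gv`), and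
  `u₀ = ρ = z/‖z‖` (`rho`),   `u₁ = g/‖g‖` (`u1`):   `T u₀ = x̄u₀ + σu₁`, `σ = ‖g‖/‖z‖`   (`Dc_rho`) —
`u₁` is the Gram–Schmidt direction of `Tu₀` against `u₀`, so `Tu₀ ∈ span{u₀, u₁}` EXACTLY (no garbage term) and the
lever of `Lemma1Lever` is `⟨u₁, Tu₀⟩ = σ`.  All estimates are termwise three-block comparisons of the moment sums
`Σ c_k p_k²` (`tsum_coef_le`, `le_tsum_coef`, majorant `maj`): `‖z‖² ∈ [1 + (4/3)a², 1 + (4/3)(a² + a⁶)]`,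
`‖z − e₀‖² ≤ (4/3)(a² + a⁶)` (`norm_sq_zv_bounds`, `norm_sq_zv_sub_e0_le`), `q(1 − 2a²) ≤ x̄ < q` (`xbar_bounds`),
`(4/3)q²a²(1 − 3a²)² ≤ ‖g‖² ≤ q²a²(4/3 + 4a² + (4/3)a⁴)` (`norm_sq_gv_bounds`; so `σ ≈ 1.15qa`),
`‖Tg‖² ≤ q⁴a⁴(4 + (8/3)a²)` (`norm_sq_Dc_gv_le`; the far block contributes only `O(a⁶)` because there `w_k ≤ qa²`).
Hence the lever inequality `(εθ)₀ = 2qa ≤ 4σ` (`lever_ge`) and the printed requirement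
`‖T*u₁‖ = ‖Tg‖/‖g‖ < 2qa = (εθ)₀` (`norm_Dc_u1_lt`), and `Lemma1.printed_lemma1_fails_of_lever` (`n₀ = x̄`, `|x̄| ≤ 1`,
`m₁ = σ`) gives `εθ(ℓ'_ε) > ½·10⁻⁵(εθ)₀` at every `ε ∈ (½ − 10⁻⁵(εθ)₀, ½]` (`printed_lemma1_fails_param`).
**Type 1 via the cyclic `u₀`, uniformly in `a`** (`cone_bound`, `type1_via_rho`): `‖z − e₀‖ ≤ 1/200`, so on the cone
`Re⟨ρ, y⟩ ≥ ‖y‖/100` of (19) one has `|y₀| ≥ ‖y‖/200`, and `⟨Tⁿy, y⟩ = Σ w_kⁿ|y_k|² ≥ qⁿ|y₀|² ≥ qⁿ‖y‖²/(4·10⁴)`: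
(19) with `j = n`, `δ_n = 10⁻²⁰ⁿ/(4·10⁴)`, the same for every `(εθ)₀`.
**Cyclicity** (`CaseII.ModelC.orbitClosure_eq_top`: a vector with no vanishing coordinate is cyclic for `D_c`):
`ρ_k > 0`; `(u₁)_k ∝ (w_k − x̄)p_k ≠ 0` since `w₀ = q > x̄ > q/2 ≥ w_k` (`k ≥ 1`) (`wgt_sub_xbar_ne_zero`);
`(y₀')_k = (√3/2)ρ_k ≠ 0`; `(x₀)_k = (√3/2)ρ_k + ½(u₁)_k` is `> 0` at `k = 0` and `< 0` for `k ≥ 1` because there the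
`u₁`-part dominates: `2‖g‖ < x̄ − w_k` (`two_norm_gv_lt`, `xStart_apply_ne_zero`).

**Quantifiers, stated exactly.**  Proved: `∃ T ∃ (δ_n) ∀ (εθ)₀ ∈ (0, 5·10⁻²³] ∃ u₀ u₁` (cyclic, Type 1 via `u₀` with
these `δ_n`, `‖T*u₁‖ < (εθ)₀`) with the printed conclusion false.  `T` and the Type-1 constants do not depend on
`(εθ)₀`; the witness `u₀ = ρ` does (`ρ → e₀` as `(εθ)₀ → 0`), as it must in any garbage-free model: for FIXED `(T, u₀)`
the Gram–Schmidt `u₁` is fixed and `‖T*u₁‖ ≥ |⟨T*u₁, u₀⟩| = σ > 0`, so `‖T*u₁‖ < (εθ)₀ → 0` forces a `u₁` with a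
garbage component `g' ⟂ u₀, u₁` in `Tu₀`, whose control needs a minimiser-stability estimate not attempted here (the
order `∃ T u₀ (δ_n) ∀ (εθ)₀ ∃ u₁` is left open).  The manuscript's own stated dependencies — `(εθ)₀` small against
the `δ_k` and `n₀`, which are "independent of εθ" (p. 8, p. 20) — are met uniformly by the family above.
So neither working in the regime `(εθ)₀ ≪ δ₁, δ₂, …` nor insisting that `u₀`, `u₁`, `x₀`, `y₀'` be cyclic rescues the
printed choice "`u₁` such that `‖T*u₁‖ < (εθ)₀`" of p. 7; the defect is the one isolated in `Lemma1Lever` (the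
argument needs the single coefficient `|⟨T*u₁, u₀⟩| ≲ 2·10⁻⁵(εθ)₀`, not the norm), and the REPAIRED Lemma 1
(`Lemma1.lemma1_repaired`, `‖T*u₁‖ ≤ 1.25·10⁻⁶(εθ)₀`, realisable for cyclic `u₀` by
`Lemma1.exists_unit_orthogonal_adjoint_le`) is unaffected.  Not modelled (and not a hypothesis of Lemma 1): absence
of invariant subspaces — `D_c` is diagonal.
Origin: planner-b2b-enflo-1-g12-0 (formaliser 1, gen 12), 2026-08-19.
-/

noncomputable section

open scoped InnerProductSpace ENNReal
open ContinuousLinearMap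

namespace Literature.Analysis.OperatorTheory.Enflo2023

namespace Lemma1

namespace Cyclic

open Vy
open CaseII.ModelC (Dc wgt Dc_apply wgt_pos wgt_le wgt_zero lam_pos_le norm_Dc norm_Dc_le norm_Dc_lt_one
  Dc_isSelfAdjoint Dc_injective Dc_denseRange Dc_not_surjective zero_mem_spectrum_Dc orbitClosure_eq_top
  inner_Dc_iterate summable_wgt_pow_mul_sq inner_self_Dc wgt_le_wgt_succ)
open CaseII.WindowModelT (lam lam_def)
open Literature.Analysis.OperatorTheory.Enflo2023.Lemma1.Standing (e e_apply norm_e inner_e_left)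
open Literature.Analysis.UnboundedOperators (inner_self_eq_coe_norm_sq)

/-! ### Bookkeeping: three-block geometric majorants -/

/-- The three-block comparison sequence: `A` at `k = 0`, `B·4^{-k}` for `1 ≤ k < K`, `C·4^{-(k-K)}` for `k ≥ K`
(written with squares of `2^{-k}` to match the profile below). [folklore] -/
def maj (A B C : ℝ) (K k : ℕ) : ℝ :=
  if k = 0 then A else if k < K then B * ((1 / 2 : ℝ) ^ k) ^ 2 else C * ((1 / 2 : ℝ) ^ (k - K)) ^ 2

/-- `(2^{-i})² = 4^{-i}`. [folklore] -/
lemma half_pow_sq (i : ℕ) : ((1 / 2 : ℝ) ^ i) ^ 2 = (1 / 4 : ℝ) ^ i := by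
  rw [← pow_mul, mul_comm, pow_mul]; norm_num

/-- The far block of the majorant, re-indexed from `K`. [folklore] -/
lemma maj_add (A B C : ℝ) {K : ℕ} (hK : 1 ≤ K) (i : ℕ) : maj A B C K (i + K) = C * (1 / 4 : ℝ) ^ i := by
  unfold maj
  rw [if_neg (by omega), if_neg (by omega), Nat.add_sub_cancel, half_pow_sq]

/-- The majorant is summable. [folklore] -/
lemma summable_maj (A B C : ℝ) {K : ℕ} (hK : 1 ≤ K) : Summable (maj A B C K) := by
  have h : (fun i => maj A B C K (i + K)) = fun i => C * (1 / 4 : ℝ) ^ i := funext (maj_add A B C hK)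
  rw [← summable_nat_add_iff K, h]
  exact (summable_geometric_of_lt_one (by norm_num) (by norm_num)).mul_left C

/-- The far block sums to `(4/3)·C`. [folklore] -/
lemma tsum_maj_far (A B C : ℝ) {K : ℕ} (hK : 1 ≤ K) : ∑' i, maj A B C K (i + K) = 4 / 3 * C := by
  rw [tsum_congr (maj_add A B C hK), tsum_mul_left, tsum_geometric_of_lt_one (by norm_num) (by norm_num)]
  norm_num; ring

/-- The head block is at most `A + (4/3)·B` (`A, B ≥ 0`). [folklore] -/
lemma sum_range_maj_le (A B C : ℝ) (hA : 0 ≤ A) (hB : 0 ≤ B) (K : ℕ) :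
    ∑ i ∈ Finset.range K, maj A B C K i ≤ A + 4 / 3 * B := by
  classical
  have h1 : ∀ i ∈ Finset.range K, maj A B C K i ≤ (if i = 0 then A else 0) + B * (1 / 4 : ℝ) ^ i := by
    intro i hi
    rw [Finset.mem_range] at hi
    by_cases h0 : i = 0
    · subst h0
      simp only [maj, if_true, pow_zero, mul_one]
      linarith
    · have : maj A B C K i = B * (1 / 4 : ℝ) ^ i := by
        simp only [maj, if_neg h0, if_pos hi, half_pow_sq]
      rw [this, if_neg h0, zero_add]
  refine (Finset.sum_le_sum h1).trans ?_
  rw [Finset.sum_add_distrib, Finset.sum_ite_eq' (Finset.range K) 0 (fun _ => A), ← Finset.mul_sum]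
  have h2 : ∑ i ∈ Finset.range K, (1 / 4 : ℝ) ^ i ≤ 4 / 3 := by
    have := sum_le_hasSum (Finset.range K) (fun i _ => by positivity)
      (hasSum_geometric_of_lt_one (by norm_num : (0 : ℝ) ≤ 1 / 4) (by norm_num))
    norm_num at this
    exact this
  have h3 : (if (0 : ℕ) ∈ Finset.range K then A else 0) ≤ A := by split_ifs <;> linarith
  nlinarith

/-- The head block of `maj A 0 C` sums to exactly `A` (`K ≥ 1`). [folklore] -/
lemma sum_range_maj_zero_mid (A C : ℝ) {K : ℕ} (hK : 1 ≤ K) :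
    ∑ i ∈ Finset.range K, maj A 0 C K i = A := by
  classical
  have h1 : ∀ i ∈ Finset.range K, maj A 0 C K i = if i = 0 then A else 0 := by
    intro i hi
    rw [Finset.mem_range] at hi
    by_cases h0 : i = 0
    · subst h0; simp [maj]
    · simp only [maj, if_neg h0, if_pos hi, zero_mul]
  rw [Finset.sum_congr rfl h1, Finset.sum_ite_eq' (Finset.range K) 0 (fun _ => A), if_pos]
  exact Finset.mem_range.mpr (by omega)

/-- `Σ_k maj A B C K k ≤ A + (4/3)B + (4/3)C` (`A, B ≥ 0`, `K ≥ 1`). [folklore] -/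
lemma tsum_maj_le (A B C : ℝ) (hA : 0 ≤ A) (hB : 0 ≤ B) {K : ℕ} (hK : 1 ≤ K) :
    ∑' k, maj A B C K k ≤ A + 4 / 3 * B + 4 / 3 * C := by
  rw [← (summable_maj A B C hK).sum_add_tsum_nat_add K, tsum_maj_far A B C hK]
  have := sum_range_maj_le A B C hA hB K
  linarith

/-- `Σ_k maj A 0 C K k = A + (4/3)C` (`K ≥ 1`). [folklore] -/
lemma tsum_maj_zero_mid (A C : ℝ) {K : ℕ} (hK : 1 ≤ K) : ∑' k, maj A 0 C K k = A + 4 / 3 * C := by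
  rw [← (summable_maj A 0 C hK).sum_add_tsum_nat_add K, tsum_maj_far A 0 C hK, sum_range_maj_zero_mid A C hK]

/-! ### The profile of `z = e₀ + r` and the two starting indices -/

/-- `K(a) = ⌈1/a²⌉₊`, the index where the far block starts (so that `w_k ≤ 10⁻²⁰a²` for `k ≥ K`). [folklore] -/
def Kof (a : ℝ) : ℕ := ⌈1 / a ^ 2⌉₊

/-- `K(a) ≥ 1`. [folklore] -/
lemma one_le_Kof {a : ℝ} (ha : 0 < a) : 1 ≤ Kof a := Nat.one_le_ceil_iff.mpr (by positivity)

/-- `1/(K(a)+1) ≤ a²`. [folklore] -/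
lemma inv_Kof_succ_le {a : ℝ} (ha : 0 < a) : 1 / ((Kof a : ℝ) + 1) ≤ a ^ 2 := by
  have h1 : 1 / a ^ 2 ≤ (Kof a : ℝ) := Nat.le_ceil _
  rw [div_le_iff₀ (by positivity)]
  have h2 : a ^ 2 * (1 / a ^ 2) = 1 := by field_simp
  nlinarith [sq_nonneg a]

/-- The coordinate profile of `z`: `1` at `k = 0`, `a³2^{-k}` on `1 ≤ k < K`, `a·2^{-(k-K)}` on `k ≥ K`. [folklore] -/
def pz (a : ℝ) (K k : ℕ) : ℝ :=
  if k = 0 then 1 else if k < K then a ^ 3 * (1 / 2 : ℝ) ^ k else a * (1 / 2 : ℝ) ^ (k - K)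

/-- `p_0 = 1`. [folklore] -/
@[simp] lemma pz_zero (a : ℝ) (K : ℕ) : pz a K 0 = 1 := by simp [pz]

/-- All profile entries are positive (`a > 0`). [folklore] -/
lemma pz_pos {a : ℝ} (ha : 0 < a) (K k : ℕ) : 0 < pz a K k := by
  unfold pz; split_ifs <;> positivity

/-- **Upper three-block bound.** If `0 ≤ c_k` with `c_0 ≤ A`, `c_k ≤ B` on the near block and `c_k ≤ C` on the far
block, then `Σ c_k p_k²` converges and is `≤ A + (4/3)Ba⁶ + (4/3)Ca²`. [folklore] -/
lemma tsum_coef_le {a : ℝ} {K : ℕ} (hK : 1 ≤ K) {c : ℕ → ℝ} {A B C : ℝ} (hc : ∀ k, 0 ≤ c k) (hB : 0 ≤ B)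
    (h0 : c 0 ≤ A) (hnear : ∀ k, 1 ≤ k → k < K → c k ≤ B) (hfar : ∀ k, K ≤ k → c k ≤ C) :
    Summable (fun k => c k * pz a K k ^ 2) ∧
      ∑' k, c k * pz a K k ^ 2 ≤ A + 4 / 3 * (B * a ^ 6) + 4 / 3 * (C * a ^ 2) := by
  have hA : 0 ≤ A := (hc 0).trans h0
  have hle : ∀ k, c k * pz a K k ^ 2 ≤ maj A (B * a ^ 6) (C * a ^ 2) K k := by
    intro k
    unfold pz maj
    by_cases hk0 : k = 0
    · rw [if_pos hk0, if_pos hk0, hk0]; linarith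
    · rw [if_neg hk0, if_neg hk0]
      by_cases hkK : k < K
      · rw [if_pos hkK, if_pos hkK]
        have h := hnear k (by omega) hkK
        have : 0 ≤ a ^ 6 * ((1 / 2 : ℝ) ^ k) ^ 2 := by positivity
        nlinarith
      · rw [if_neg hkK, if_neg hkK]
        have h := hfar k (by omega)
        have : 0 ≤ a ^ 2 * ((1 / 2 : ℝ) ^ (k - K)) ^ 2 := by positivity
        nlinarith
  have hs : Summable (fun k => c k * pz a K k ^ 2) :=
    Summable.of_nonneg_of_le (fun k => mul_nonneg (hc k) (sq_nonneg _)) hle (summable_maj _ _ _ hK)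
  exact ⟨hs, (Summable.tsum_le_tsum hle hs (summable_maj _ _ _ hK)).trans
    (tsum_maj_le _ _ _ hA (by positivity) hK)⟩

/-- **Lower two-block bound.** If `Σ c_k p_k²` converges, `0 ≤ c_k`, `A ≤ c_0` and `C ≤ c_k` on the far block, then
`A + (4/3)Ca² ≤ Σ c_k p_k²`. [folklore] -/
lemma le_tsum_coef {a : ℝ} {K : ℕ} (hK : 1 ≤ K) {c : ℕ → ℝ} {A C : ℝ} (hc : ∀ k, 0 ≤ c k)
    (hs : Summable (fun k => c k * pz a K k ^ 2)) (h0 : A ≤ c 0) (hfar : ∀ k, K ≤ k → C ≤ c k) :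
    A + 4 / 3 * (C * a ^ 2) ≤ ∑' k, c k * pz a K k ^ 2 := by
  have hle : ∀ k, maj A 0 (C * a ^ 2) K k ≤ c k * pz a K k ^ 2 := by
    intro k
    unfold pz maj
    by_cases hk0 : k = 0
    · rw [if_pos hk0, if_pos hk0, hk0]; linarith
    · rw [if_neg hk0, if_neg hk0]
      by_cases hkK : k < K
      · rw [if_pos hkK, if_pos hkK, zero_mul]
        exact mul_nonneg (hc k) (sq_nonneg _)
      · rw [if_neg hkK, if_neg hkK]
        have h := hfar k (by omega)
        have : 0 ≤ a ^ 2 * ((1 / 2 : ℝ) ^ (k - K)) ^ 2 := by positivity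
        nlinarith
  rw [← tsum_maj_zero_mid A (C * a ^ 2) hK]
  exact Summable.tsum_le_tsum hle (summable_maj _ _ _ hK) hs


/-- Powers of `a ≤ 1/400`. [folklore] -/
lemma apow_bounds {a : ℝ} (ha : 0 < a) (ha1 : a ≤ 1 / 400) :
    a ^ 2 ≤ 1 / 160000 ∧ a ^ 4 ≤ a ^ 2 / 160000 ∧ a ^ 6 ≤ a ^ 2 / 160000 ∧ a ^ 8 ≤ a ^ 2 / 160000 := by
  have h2 : a ^ 2 ≤ 1 / 160000 := by nlinarith
  have h2' : a ^ 2 ≤ 1 := by linarith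
  have h4 : a ^ 4 ≤ a ^ 2 / 160000 := by nlinarith [sq_nonneg a]
  have h6 : a ^ 6 ≤ a ^ 2 / 160000 := by nlinarith [pow_nonneg ha.le 4]
  have h8 : a ^ 8 ≤ a ^ 2 / 160000 := by nlinarith [pow_nonneg ha.le 6]
  exact ⟨h2, h4, h6, h8⟩

/-! ### The weights on the three blocks -/

/-- `w_k ≤ 10⁻²⁰/2` for `k ≥ 1`. [folklore] -/
lemma wgt_le_half {k : ℕ} (hk : 1 ≤ k) : wgt k ≤ lam / 2 := by
  have h := wgt_le_wgt_succ (m := 0) (k := k) (by omega)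
  have h1 : wgt (0 + 1) = lam / 2 := by unfold wgt; norm_num
  linarith

/-- `w_k ≤ 10⁻²⁰a²` on the far block `k ≥ K`, when `1/(K+1) ≤ a²`. [folklore] -/
lemma wgt_le_far {a : ℝ} {K k : ℕ} (hKa : 1 / ((K : ℝ) + 1) ≤ a ^ 2) (hk : K ≤ k) : wgt k ≤ lam * a ^ 2 := by
  have hl := lam_pos_le.1.le
  have h1 : (K : ℝ) + 1 ≤ (k : ℝ) + 1 := by
    have : (K : ℝ) ≤ k := by exact_mod_cast hk
    linarith
  unfold wgt
  calc lam / ((k : ℝ) + 1) = lam * (1 / ((k : ℝ) + 1)) := by ring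
    _ ≤ lam * (1 / ((K : ℝ) + 1)) :=
        mul_le_mul_of_nonneg_left (one_div_le_one_div_of_le (by positivity) h1) hl
    _ ≤ lam * a ^ 2 := mul_le_mul_of_nonneg_left hKa hl

/-! ### The vector `z = e₀ + r` -/

/-- The far-block squares are summable (shifted geometric series). [folklore] -/
lemma summable_far_sq (a : ℝ) (K : ℕ) : Summable (fun k => a ^ 2 * ((1 / 2 : ℝ) ^ (k - K)) ^ 2) := by
  rw [← summable_nat_add_iff K]
  have h : (fun i => a ^ 2 * ((1 / 2 : ℝ) ^ (i + K - K)) ^ 2) = fun i => a ^ 2 * (1 / 4 : ℝ) ^ i := by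
    funext i; rw [Nat.add_sub_cancel, half_pow_sq]
  rw [h]
  exact (summable_geometric_of_lt_one (by norm_num) (by norm_num)).mul_left _

/-- `Σ p_k² < ∞`. [folklore] -/
lemma summable_pz_sq (a : ℝ) (K : ℕ) : Summable (fun k => pz a K k ^ 2) := by
  have h1 : Summable (fun k => (1 + a ^ 6) * ((1 / 2 : ℝ) ^ k) ^ 2) := by
    simp_rw [half_pow_sq]
    exact (summable_geometric_of_lt_one (by norm_num) (by norm_num)).mul_left _
  refine Summable.of_nonneg_of_le (fun k => sq_nonneg _) (fun k => ?_) (h1.add (summable_far_sq a K))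
  have h6 : (0 : ℝ) ≤ a ^ 6 * ((1 / 2 : ℝ) ^ k) ^ 2 := by positivity
  have hq : (0 : ℝ) ≤ ((1 / 2 : ℝ) ^ k) ^ 2 := by positivity
  have hf : (0 : ℝ) ≤ a ^ 2 * ((1 / 2 : ℝ) ^ (k - K)) ^ 2 := by positivity
  unfold pz
  split_ifs with h0 hK
  · subst h0
    simp only [pow_zero, one_pow, mul_one]
    have : (0 : ℝ) ≤ a ^ 6 := by positivity
    have : (0 : ℝ) ≤ a ^ 2 * ((1 / 2 : ℝ) ^ (0 - K)) ^ 2 := by positivity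
    linarith
  · rw [mul_pow, show (a ^ 3) ^ 2 = a ^ 6 by ring]
    nlinarith
  · rw [mul_pow]
    nlinarith

/-- The profile sequence (cast to `ℂ`) is square-summable. [folklore] -/
lemma memℓp_pz (a : ℝ) (K : ℕ) : Memℓp (fun k => ((pz a K k : ℝ) : ℂ)) 2 := by
  rw [memℓp_gen_iff (by norm_num : 0 < (2 : ℝ≥0∞).toReal)]
  simp only [ENNReal.toReal_ofNat, Real.rpow_two, Complex.norm_real, Real.norm_eq_abs, sq_abs]
  exact summable_pz_sq a K

/-- **`z = e₀ + r`**: the (un-normalised) cyclic replacement of `u₀ = e₀`, all coordinates real and positive.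
[cite: Enflo2023, v2 p.6, (19)] -/
def zv (a : ℝ) (K : ℕ) : ℓ2 := ⟨fun k => ((pz a K k : ℝ) : ℂ), memℓp_pz a K⟩

/-- Coordinates of `z`. [folklore] -/
@[simp] lemma zv_apply (a : ℝ) (K k : ℕ) : zv a K k = ((pz a K k : ℝ) : ℂ) := rfl

/-- `|z_k|² = p_k²`. [folklore] -/
lemma norm_sq_zv_apply (a : ℝ) (K k : ℕ) : ‖zv a K k‖ ^ 2 = pz a K k ^ 2 := by
  rw [zv_apply, Complex.norm_real, Real.norm_eq_abs, sq_abs]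

/-- `‖z‖² = Σ p_k²`. [folklore] -/
lemma norm_sq_zv (a : ℝ) (K : ℕ) : ‖zv a K‖ ^ 2 = ∑' k, pz a K k ^ 2 := by
  rw [norm_sq_eq_tsum]; simp only [norm_sq_zv_apply]

/-- `1 + (4/3)a² ≤ ‖z‖² ≤ 1 + (4/3)a⁶ + (4/3)a²`. [folklore] -/
lemma norm_sq_zv_bounds (a : ℝ) {K : ℕ} (hK : 1 ≤ K) :
    1 + 4 / 3 * a ^ 2 ≤ ‖zv a K‖ ^ 2 ∧ ‖zv a K‖ ^ 2 ≤ 1 + 4 / 3 * a ^ 6 + 4 / 3 * a ^ 2 := by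
  rw [norm_sq_zv]
  have hu := tsum_coef_le (a := a) hK (c := fun _ => (1 : ℝ)) (A := 1) (B := 1) (C := 1)
    (fun _ => zero_le_one) zero_le_one le_rfl (fun _ _ _ => le_rfl) (fun _ _ => le_rfl)
  have hl := le_tsum_coef (a := a) hK (c := fun _ => (1 : ℝ)) (A := 1) (C := 1) (fun _ => zero_le_one) hu.1
    le_rfl (fun _ _ => le_rfl)
  simp only [one_mul] at hu hl
  exact ⟨hl, hu.2⟩

/-- `‖z‖ ≥ 1`, in particular `z ≠ 0`. [folklore] -/
lemma one_le_norm_zv (a : ℝ) {K : ℕ} (hK : 1 ≤ K) : 1 ≤ ‖zv a K‖ := by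
  have h := (norm_sq_zv_bounds a hK).1
  have h2 : (1 : ℝ) ^ 2 ≤ ‖zv a K‖ ^ 2 := by nlinarith [sq_nonneg a]
  exact le_of_pow_le_pow_left₀ two_ne_zero (norm_nonneg _) h2

/-- `‖z − e₀‖² ≤ (4/3)(a⁶ + a²)` (the perturbation `r` is small). [folklore] -/
lemma norm_sq_zv_sub_e0_le (a : ℝ) {K : ℕ} (hK : 1 ≤ K) :
    ‖zv a K - e 0‖ ^ 2 ≤ 4 / 3 * a ^ 6 + 4 / 3 * a ^ 2 := by
  classical
  have hc : ∀ k, ‖(zv a K - e 0) k‖ ^ 2 = (if k = 0 then (0 : ℝ) else 1) * pz a K k ^ 2 := by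
    intro k
    rw [lp.coeFn_sub, Pi.sub_apply, zv_apply, e_apply]
    by_cases hk : k = 0
    · subst hk; simp
    · rw [if_neg hk, if_neg hk, sub_zero, Complex.norm_real, Real.norm_eq_abs, sq_abs, one_mul]
  rw [norm_sq_eq_tsum]
  simp only [hc]
  have hu := tsum_coef_le (a := a) hK (c := fun k => if k = 0 then (0 : ℝ) else 1) (A := 0) (B := 1) (C := 1)
    (fun k => by split_ifs <;> norm_num) zero_le_one (by simp) (fun k _ _ => by split_ifs <;> norm_num)
    (fun k _ => by split_ifs <;> norm_num)
  have := hu.2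
  simp only [one_mul, zero_add] at this
  exact this

/-! ### `S₁ = ⟨z, D_c z⟩`, the Rayleigh quotient `x̄` and the Gram–Schmidt vector `g = D_c z − x̄ z` -/

/-- `S₁ = Σ w_k p_k²`. [folklore] -/
def S1 (a : ℝ) (K : ℕ) : ℝ := ∑' k, wgt k * pz a K k ^ 2

/-- `⟨z, D_c z⟩ = S₁`. [folklore] -/
lemma inner_zv_Dc (a : ℝ) (K : ℕ) : ⟪zv a K, Dc (zv a K)⟫_ℂ = ((S1 a K : ℝ) : ℂ) := by
  rw [inner_self_Dc]
  unfold S1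
  congr 1
  exact tsum_congr (fun k => by rw [norm_sq_zv_apply])

/-- `10⁻²⁰ ≤ S₁ ≤ 10⁻²⁰(1 + (4/3)a⁶ + (4/3)a⁴)`. [folklore] -/
lemma S1_bounds (a : ℝ) {K : ℕ} (hK : 1 ≤ K) (hKa : 1 / ((K : ℝ) + 1) ≤ a ^ 2) :
    lam ≤ S1 a K ∧ S1 a K ≤ lam + 4 / 3 * (lam * a ^ 6) + 4 / 3 * (lam * a ^ 2 * a ^ 2) := by
  have hl := lam_pos_le.1.le
  have hu := tsum_coef_le (a := a) hK (c := fun k => wgt k) (A := lam) (B := lam) (C := lam * a ^ 2)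
    (fun k => (wgt_pos k).le) hl (wgt_zero).le (fun k _ _ => wgt_le k) (fun k hk => wgt_le_far hKa hk)
  have hlow := le_tsum_coef (a := a) hK (c := fun k => wgt k) (A := lam) (C := 0) (fun k => (wgt_pos k).le) hu.1
    (wgt_zero).ge (fun k _ => (wgt_pos k).le)
  unfold S1
  refine ⟨by linarith, hu.2⟩

/-- **The Rayleigh quotient `x̄ = ⟨z, D_c z⟩/‖z‖²`** (real). [folklore] -/
def xbar (a : ℝ) (K : ℕ) : ℝ := S1 a K / ‖zv a K‖ ^ 2

/-- `10⁻²⁰(1 − 2a²) ≤ x̄ < 10⁻²⁰` (`0 < a ≤ 1/400`, `1/(K+1) ≤ a²`). [folklore] -/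
lemma xbar_bounds {a : ℝ} (ha : 0 < a) (ha1 : a ≤ 1 / 400) {K : ℕ} (hK : 1 ≤ K)
    (hKa : 1 / ((K : ℝ) + 1) ≤ a ^ 2) : lam * (1 - 2 * a ^ 2) ≤ xbar a K ∧ xbar a K < lam := by
  obtain ⟨hZ1, hZ2⟩ := norm_sq_zv_bounds a hK
  obtain ⟨hS1, hS2⟩ := S1_bounds a hK hKa
  obtain ⟨h2, h4, h6, h8⟩ := apow_bounds ha ha1
  have hZpos : 0 < ‖zv a K‖ ^ 2 := by nlinarith [sq_nonneg a]
  have ha2 : 0 < a ^ 2 := by positivity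
  unfold xbar
  rw [le_div_iff₀ hZpos, div_lt_iff₀ hZpos, lam_def]
  rw [lam_def] at hS1 hS2
  constructor
  · have h1 : 1 / 10 ^ 20 * (1 - 2 * a ^ 2) * ‖zv a K‖ ^ 2 ≤
        1 / 10 ^ 20 * (1 - 2 * a ^ 2) * (1 + 4 / 3 * a ^ 6 + 4 / 3 * a ^ 2) :=
      mul_le_mul_of_nonneg_left hZ2 (by nlinarith)
    nlinarith
  · nlinarith

/-- `0 ≤ x̄ ≤ 1` (indeed `x̄ < 10⁻²⁰`). [folklore] -/
lemma xbar_nonneg_le_one {a : ℝ} (ha : 0 < a) (ha1 : a ≤ 1 / 400) {K : ℕ} (hK : 1 ≤ K)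
    (hKa : 1 / ((K : ℝ) + 1) ≤ a ^ 2) : 0 ≤ xbar a K ∧ xbar a K ≤ 1 := by
  obtain ⟨h1, h2⟩ := xbar_bounds ha ha1 hK hKa
  obtain ⟨ha2, -⟩ := apow_bounds ha ha1
  rw [lam_def] at h1 h2
  constructor <;> nlinarith

/-- **`g = D_c z − x̄ z`** (Gram–Schmidt: the component of `D_c z` orthogonal to `z`). [cite: Enflo2023, v2 p.7 (choice of u₁)] -/
def gv (a : ℝ) (K : ℕ) : ℓ2 := Dc (zv a K) - ((xbar a K : ℝ) : ℂ) • zv a K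

/-- Coordinates of `g`: `g_k = (w_k − x̄)p_k`. [folklore] -/
lemma gv_apply (a : ℝ) (K k : ℕ) : gv a K k = (((wgt k - xbar a K) * pz a K k : ℝ) : ℂ) := by
  unfold gv
  rw [lp.coeFn_sub, Pi.sub_apply, lp.coeFn_smul, Pi.smul_apply, Dc_apply, zv_apply, smul_eq_mul]
  push_cast
  ring

/-- `|g_k|² = (w_k − x̄)²p_k²`. [folklore] -/
lemma norm_sq_gv_apply (a : ℝ) (K k : ℕ) : ‖gv a K k‖ ^ 2 = (wgt k - xbar a K) ^ 2 * pz a K k ^ 2 := by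
  rw [gv_apply, Complex.norm_real, Real.norm_eq_abs, sq_abs, mul_pow]

/-- `‖g‖² = Σ (w_k − x̄)²p_k²`. [folklore] -/
lemma norm_sq_gv (a : ℝ) (K : ℕ) : ‖gv a K‖ ^ 2 = ∑' k, (wgt k - xbar a K) ^ 2 * pz a K k ^ 2 := by
  rw [norm_sq_eq_tsum]; simp only [norm_sq_gv_apply]

/-- **`‖g‖² ≍ (4/3)·10⁻⁴⁰a²`**: `(4/3)10⁻⁴⁰(1 − 3a²)²a² ≤ ‖g‖² ≤ 10⁻⁴⁰(4a⁴ + (4/3)a⁶ + (4/3)a²)`. [folklore] -/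
lemma norm_sq_gv_bounds {a : ℝ} (ha : 0 < a) (ha1 : a ≤ 1 / 400) {K : ℕ} (hK : 1 ≤ K)
    (hKa : 1 / ((K : ℝ) + 1) ≤ a ^ 2) :
    4 / 3 * ((lam * (1 - 3 * a ^ 2)) ^ 2 * a ^ 2) ≤ ‖gv a K‖ ^ 2 ∧
      ‖gv a K‖ ^ 2 ≤ 4 * lam ^ 2 * a ^ 4 + 4 / 3 * (lam ^ 2 * a ^ 6) + 4 / 3 * (lam ^ 2 * a ^ 2) := by
  obtain ⟨hx1, hx2⟩ := xbar_bounds ha ha1 hK hKa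
  obtain ⟨ha2, -⟩ := apow_bounds ha ha1
  have hl := lam_pos_le.1
  have hsq : ∀ k, (wgt k - xbar a K) ^ 2 ≤ lam ^ 2 := by
    intro k
    have hw0 := wgt_pos k
    have hw1 := wgt_le k
    have hx0 : 0 ≤ xbar a K := by rw [lam_def] at hx1; nlinarith
    have := mul_nonneg (show 0 ≤ lam - (wgt k - xbar a K) by linarith)
      (show 0 ≤ lam + (wgt k - xbar a K) by linarith)
    nlinarith
  have hu := tsum_coef_le (a := a) hK (c := fun k => (wgt k - xbar a K) ^ 2) (A := 4 * lam ^ 2 * a ^ 4)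
    (B := lam ^ 2) (C := lam ^ 2) (fun k => sq_nonneg _) (by positivity)
    (by
      show (wgt 0 - xbar a K) ^ 2 ≤ 4 * lam ^ 2 * a ^ 4
      rw [wgt_zero]
      have h0 : 0 ≤ lam - xbar a K := by linarith
      have : lam - xbar a K ≤ 2 * lam * a ^ 2 := by nlinarith
      nlinarith)
    (fun k _ _ => hsq k) (fun k _ => hsq k)
  have hlow := le_tsum_coef (a := a) hK (c := fun k => (wgt k - xbar a K) ^ 2) (A := 0)
    (C := (lam * (1 - 3 * a ^ 2)) ^ 2) (fun k => sq_nonneg _) hu.1 (sq_nonneg _)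
    (fun k hk => by
      have hw := wgt_le_far hKa hk
      have h1 : lam * (1 - 3 * a ^ 2) ≤ xbar a K - wgt k := by nlinarith
      have h0 : 0 ≤ lam * (1 - 3 * a ^ 2) := by nlinarith
      calc (lam * (1 - 3 * a ^ 2)) ^ 2 ≤ (xbar a K - wgt k) ^ 2 := pow_le_pow_left₀ h0 h1 2
        _ = (wgt k - xbar a K) ^ 2 := by ring)
  rw [norm_sq_gv]
  exact ⟨by linarith, hu.2⟩

/-- `‖g‖ > 0`. [folklore] -/
lemma norm_gv_pos {a : ℝ} (ha : 0 < a) (ha1 : a ≤ 1 / 400) {K : ℕ} (hK : 1 ≤ K)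
    (hKa : 1 / ((K : ℝ) + 1) ≤ a ^ 2) : 0 < ‖gv a K‖ := by
  have h := (norm_sq_gv_bounds ha ha1 hK hKa).1
  obtain ⟨ha2, -⟩ := apow_bounds ha ha1
  have hl := lam_pos_le.1
  have hpos : 0 < 4 / 3 * ((lam * (1 - 3 * a ^ 2)) ^ 2 * a ^ 2) := by
    have : 0 < lam * (1 - 3 * a ^ 2) := by nlinarith
    positivity
  have h2 : 0 < ‖gv a K‖ ^ 2 := by linarith
  exact lt_of_pow_lt_pow_left₀ 2 (norm_nonneg _) (by rw [zero_pow two_ne_zero]; exact h2)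


/-- The power chain `a⁴ ≤ a²/160000`, `a⁶ ≤ a⁴/160000`, `a⁸ ≤ a⁶/160000` for `0 < a ≤ 1/400`. [folklore] -/
lemma apow_chain {a : ℝ} (ha : 0 < a) (ha1 : a ≤ 1 / 400) :
    a ^ 4 ≤ a ^ 2 / 160000 ∧ a ^ 6 ≤ a ^ 4 / 160000 ∧ a ^ 8 ≤ a ^ 6 / 160000 := by
  have h2 : a ^ 2 ≤ 1 / 160000 := by nlinarith
  refine ⟨by nlinarith [sq_nonneg a], by nlinarith [pow_nonneg ha.le 4], by nlinarith [pow_nonneg ha.le 6]⟩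

/-- `(w_k − x̄)² ≤ 10⁻⁴⁰` (both `w_k` and `x̄` lie in `[0, 10⁻²⁰]`). [folklore] -/
lemma sq_wgt_sub_xbar_le {a : ℝ} (ha : 0 < a) (ha1 : a ≤ 1 / 400) {K : ℕ} (hK : 1 ≤ K)
    (hKa : 1 / ((K : ℝ) + 1) ≤ a ^ 2) (k : ℕ) : (wgt k - xbar a K) ^ 2 ≤ lam ^ 2 := by
  obtain ⟨hx1, hx2⟩ := xbar_bounds ha ha1 hK hKa
  obtain ⟨ha2, -⟩ := apow_bounds ha ha1
  have hl := lam_pos_le.1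
  have hw0 := wgt_pos k
  have hw1 := wgt_le k
  have hx0 : 0 ≤ xbar a K := by rw [lam_def] at hx1; nlinarith
  have := mul_nonneg (show 0 ≤ lam - (wgt k - xbar a K) by linarith)
    (show 0 ≤ lam + (wgt k - xbar a K) by linarith)
  nlinarith

/-- Coordinates of `D_c g`: `(D_c g)_k = w_k(w_k − x̄)p_k`. [folklore] -/
lemma Dc_gv_apply (a : ℝ) (K k : ℕ) :
    Dc (gv a K) k = (((wgt k * (wgt k - xbar a K)) * pz a K k : ℝ) : ℂ) := by
  rw [Dc_apply, gv_apply]; push_cast; ring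

/-- `|(D_c g)_k|² = w_k²(w_k − x̄)²p_k²`. [folklore] -/
lemma norm_sq_Dc_gv_apply (a : ℝ) (K k : ℕ) :
    ‖Dc (gv a K) k‖ ^ 2 = (wgt k * (wgt k - xbar a K)) ^ 2 * pz a K k ^ 2 := by
  rw [Dc_gv_apply, Complex.norm_real, Real.norm_eq_abs, sq_abs, mul_pow]

/-- **`‖D_c g‖² ≤ 10⁻⁸⁰(4a⁴ + (8/3)a⁶)`**: the head coordinate contributes `10⁻⁴⁰(10⁻²⁰ − x̄)² ≤ 4·10⁻⁸⁰a⁴`, the far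
block only `O(a⁶)` because there `w_k ≤ 10⁻²⁰a²`. [folklore] -/
lemma norm_sq_Dc_gv_le {a : ℝ} (ha : 0 < a) (ha1 : a ≤ 1 / 400) {K : ℕ} (hK : 1 ≤ K)
    (hKa : 1 / ((K : ℝ) + 1) ≤ a ^ 2) :
    ‖Dc (gv a K)‖ ^ 2 ≤ 4 * lam ^ 4 * a ^ 4 + 4 / 3 * (lam ^ 4 * a ^ 6) + 4 / 3 * (lam ^ 4 * a ^ 4 * a ^ 2) := by
  obtain ⟨hx1, hx2⟩ := xbar_bounds ha ha1 hK hKa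
  obtain ⟨ha2, -⟩ := apow_bounds ha ha1
  have hl := lam_pos_le.1
  have hsq := sq_wgt_sub_xbar_le ha ha1 hK hKa
  have hu := tsum_coef_le (a := a) hK (c := fun k => (wgt k * (wgt k - xbar a K)) ^ 2)
    (A := 4 * lam ^ 4 * a ^ 4) (B := lam ^ 4) (C := lam ^ 4 * a ^ 4) (fun k => sq_nonneg _) (by positivity)
    (by
      show (wgt 0 * (wgt 0 - xbar a K)) ^ 2 ≤ 4 * lam ^ 4 * a ^ 4
      rw [wgt_zero, mul_pow]
      have h0 : 0 ≤ lam - xbar a K := by linarith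
      have h1 : lam - xbar a K ≤ 2 * lam * a ^ 2 := by nlinarith
      have h3 : (lam - xbar a K) ^ 2 ≤ (2 * lam * a ^ 2) ^ 2 := pow_le_pow_left₀ h0 h1 2
      nlinarith)
    (fun k _ _ => by
      show (wgt k * (wgt k - xbar a K)) ^ 2 ≤ lam ^ 4
      rw [mul_pow]
      have h1 : wgt k ^ 2 ≤ lam ^ 2 := pow_le_pow_left₀ (wgt_pos k).le (wgt_le k) 2
      have := mul_le_mul h1 (hsq k) (sq_nonneg _) (by positivity)
      nlinarith)
    (fun k hk => by
      show (wgt k * (wgt k - xbar a K)) ^ 2 ≤ lam ^ 4 * a ^ 4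
      rw [mul_pow]
      have h1 : wgt k ^ 2 ≤ (lam * a ^ 2) ^ 2 := pow_le_pow_left₀ (wgt_pos k).le (wgt_le_far hKa hk) 2
      have := mul_le_mul h1 (hsq k) (sq_nonneg _) (by positivity)
      nlinarith)
  rw [norm_sq_eq_tsum]
  simp only [norm_sq_Dc_gv_apply]
  exact hu.2

/-- **`z ⟂ g`** (`⟨z, g⟩ = S₁ − x̄‖z‖² = 0`). [folklore] -/
lemma inner_zv_gv (a : ℝ) {K : ℕ} (hK : 1 ≤ K) : ⟪zv a K, gv a K⟫_ℂ = 0 := by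
  have hZ : ‖zv a K‖ ^ 2 ≠ 0 := by have := one_le_norm_zv a hK; positivity
  unfold gv
  rw [inner_sub_right, inner_smul_right, inner_zv_Dc, inner_self_eq_coe_norm_sq, ← Complex.ofReal_mul,
    ← Complex.ofReal_sub, Complex.ofReal_eq_zero]
  unfold xbar
  rw [div_mul_cancel₀ _ hZ, sub_self]

/-! ### The orthonormal pair `u₀ = ρ = z/‖z‖`, `u₁ = g/‖g‖` and the exact relation `D_c ρ = x̄ρ + σu₁` -/

/-- **`u₀ = ρ = z/‖z‖`**, the cyclic unit vector replacing `e₀`. [cite: Enflo2023, v2 p.6, (19)] -/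
def rho (a : ℝ) (K : ℕ) : ℓ2 := ((‖zv a K‖⁻¹ : ℝ) : ℂ) • zv a K

/-- **`u₁ = g/‖g‖`**, the unit vector of `D_c ρ − x̄ρ` (so `u₁ ⟂ ρ` and `D_c ρ ∈ span{ρ, u₁}`: no garbage term).
[cite: Enflo2023, v2 p.7 (choice of u₁)] -/
def u1 (a : ℝ) (K : ℕ) : ℓ2 := ((‖gv a K‖⁻¹ : ℝ) : ℂ) • gv a K

/-- Coordinates of `ρ`. [folklore] -/
lemma rho_apply (a : ℝ) (K k : ℕ) : rho a K k = ((‖zv a K‖⁻¹ * pz a K k : ℝ) : ℂ) := by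
  unfold rho; rw [lp.coeFn_smul, Pi.smul_apply, zv_apply, smul_eq_mul]; push_cast; ring

/-- Coordinates of `u₁`. [folklore] -/
lemma u1_apply (a : ℝ) (K k : ℕ) :
    u1 a K k = ((‖gv a K‖⁻¹ * ((wgt k - xbar a K) * pz a K k) : ℝ) : ℂ) := by
  unfold u1; rw [lp.coeFn_smul, Pi.smul_apply, gv_apply, smul_eq_mul]; push_cast; ring

/-- `‖ρ‖ = 1`. [folklore] -/
lemma norm_rho (a : ℝ) {K : ℕ} (hK : 1 ≤ K) : ‖rho a K‖ = 1 := by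
  have hZ : ‖zv a K‖ ≠ 0 := by have := one_le_norm_zv a hK; positivity
  unfold rho
  rw [norm_smul, Complex.norm_real, Real.norm_of_nonneg (inv_nonneg.2 (norm_nonneg _)), inv_mul_cancel₀ hZ]

/-- `‖u₁‖ = 1`. [folklore] -/
lemma norm_u1 {a : ℝ} (ha : 0 < a) (ha1 : a ≤ 1 / 400) {K : ℕ} (hK : 1 ≤ K)
    (hKa : 1 / ((K : ℝ) + 1) ≤ a ^ 2) : ‖u1 a K‖ = 1 := by
  have hG : ‖gv a K‖ ≠ 0 := (norm_gv_pos ha ha1 hK hKa).ne'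
  unfold u1
  rw [norm_smul, Complex.norm_real, Real.norm_of_nonneg (inv_nonneg.2 (norm_nonneg _)), inv_mul_cancel₀ hG]

/-- `ρ ⟂ u₁`. [folklore] -/
lemma inner_rho_u1 (a : ℝ) {K : ℕ} (hK : 1 ≤ K) : ⟪rho a K, u1 a K⟫_ℂ = 0 := by
  unfold rho u1; rw [inner_smul_left, inner_smul_right, inner_zv_gv a hK, mul_zero, mul_zero]

/-- **`D_c ρ = x̄ρ + σu₁`** with `σ = ‖g‖/‖z‖`: `D_c u₀` lies EXACTLY in `span{u₀, u₁}` (`n₀ = x̄`, `m₁ = σ`, no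
garbage), so the lever of `Lemma1Lever` is `⟨u₁, D_c u₀⟩ = σ`. [cite: Enflo2023, v2 p.7 (choice of u₁)] -/
lemma Dc_rho {a : ℝ} (ha : 0 < a) (ha1 : a ≤ 1 / 400) {K : ℕ} (hK : 1 ≤ K)
    (hKa : 1 / ((K : ℝ) + 1) ≤ a ^ 2) :
    Dc (rho a K) = ((xbar a K : ℝ) : ℂ) • rho a K + ((‖zv a K‖⁻¹ * ‖gv a K‖ : ℝ) : ℂ) • u1 a K := by
  have hG : ‖gv a K‖ ≠ 0 := (norm_gv_pos ha ha1 hK hKa).ne'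
  have hdec : Dc (zv a K) = ((xbar a K : ℝ) : ℂ) • zv a K + gv a K := by
    unfold gv; abel
  unfold rho u1
  rw [map_smul, hdec, smul_add, smul_smul, smul_smul, smul_smul]
  congr 1
  · rw [mul_comm]
  · congr 1
    rw [← Complex.ofReal_mul, mul_assoc, mul_inv_cancel₀ hG, mul_one]

/-- **The lever is large: `(εθ)₀ = 2·10⁻²⁰a ≤ 4σ`** (`σ = ‖g‖/‖z‖ ≥ 1.1·10⁻²⁰a`). [folklore] -/
lemma lever_ge {a : ℝ} (ha : 0 < a) (ha1 : a ≤ 1 / 400) {K : ℕ} (hK : 1 ≤ K)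
    (hKa : 1 / ((K : ℝ) + 1) ≤ a ^ 2) : 2 * lam * a ≤ 4 * (‖zv a K‖⁻¹ * ‖gv a K‖) := by
  obtain ⟨hZ1, hZ2⟩ := norm_sq_zv_bounds a hK
  obtain ⟨hG1, hG2⟩ := norm_sq_gv_bounds ha ha1 hK hKa
  obtain ⟨h2, -⟩ := apow_bounds ha ha1
  obtain ⟨h4, h6, h8⟩ := apow_chain ha ha1
  have hl := lam_pos_le.1
  have hz := one_le_norm_zv a hK
  have hzpos : 0 < ‖zv a K‖ := by linarith
  rw [show 4 * (‖zv a K‖⁻¹ * ‖gv a K‖) = 4 * ‖gv a K‖ / ‖zv a K‖ by ring, le_div_iff₀ hzpos]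
  have hsq : (2 * lam * a * ‖zv a K‖) ^ 2 ≤ (4 * ‖gv a K‖) ^ 2 := by
    have h1 : (2 * lam * a) ^ 2 * ‖zv a K‖ ^ 2 ≤ (2 * lam * a) ^ 2 * (1 + 4 / 3 * a ^ 6 + 4 / 3 * a ^ 2) :=
      mul_le_mul_of_nonneg_left hZ2 (by positivity)
    rw [lam_def] at h1 hG1 ⊢
    nlinarith
  exact le_of_pow_le_pow_left₀ two_ne_zero (by positivity) hsq

/-- **The printed requirement holds: `‖D_c u₁‖ < (εθ)₀ = 2·10⁻²⁰a`** (`‖D_c g‖ ≤ 2.1·10⁻⁴⁰a²`,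
`‖g‖ ≥ 1.1·10⁻²⁰a`). [cite: Enflo2023, v2 p.7 (choice of u₁)] -/
lemma norm_Dc_u1_lt {a : ℝ} (ha : 0 < a) (ha1 : a ≤ 1 / 400) {K : ℕ} (hK : 1 ≤ K)
    (hKa : 1 / ((K : ℝ) + 1) ≤ a ^ 2) : ‖Dc (u1 a K)‖ < 2 * lam * a := by
  have hGpos := norm_gv_pos ha ha1 hK hKa
  obtain ⟨hG1, hG2⟩ := norm_sq_gv_bounds ha ha1 hK hKa
  have hH := norm_sq_Dc_gv_le ha ha1 hK hKa
  obtain ⟨h2, -⟩ := apow_bounds ha ha1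
  obtain ⟨h4, h6, h8⟩ := apow_chain ha ha1
  have hl := lam_pos_le.1
  have ha4 : 0 < a ^ 4 := by positivity
  unfold u1
  rw [map_smul, norm_smul, Complex.norm_real, Real.norm_of_nonneg (inv_nonneg.2 (norm_nonneg _)),
    inv_mul_lt_iff₀ hGpos]
  have hsq : ‖Dc (gv a K)‖ ^ 2 < (‖gv a K‖ * (2 * lam * a)) ^ 2 := by
    have h1 : (2 * lam * a) ^ 2 * (4 / 3 * ((lam * (1 - 3 * a ^ 2)) ^ 2 * a ^ 2)) ≤
        (2 * lam * a) ^ 2 * ‖gv a K‖ ^ 2 := mul_le_mul_of_nonneg_left hG1 (by positivity)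
    rw [lam_def] at h1 hH ⊢
    nlinarith
  exact lt_of_pow_lt_pow_left₀ 2 (by positivity) hsq

/-! ### Type 1 via the cyclic `u₀ = ρ`, with `(εθ)₀`-independent constants -/

/-- **Cone bound.** For `y` in the Type-1 cone of `ρ` (`Re⟨ρ, y⟩ ≥ ‖y‖/100`): since `‖z − e₀‖ ≤ 1/200`, `|y₀| ≥ ‖y‖/200`
and `⟨D_cⁿy, y⟩ = Σ w_kⁿ|y_k|² ≥ 10⁻²⁰ⁿ‖y‖²/(4·10⁴)` — (19) with `j = n`, `δ_n = 10⁻²⁰ⁿ/(4·10⁴)`, uniformly in `a`.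
[cite: Enflo2023, v2 p.6, (19)] -/
theorem cone_bound {a : ℝ} (ha : 0 < a) (ha1 : a ≤ 1 / 400) {K : ℕ} (hK : 1 ≤ K) (n : ℕ) (y : ℓ2)
    (hy : Referee.AngleCond (rho a K) y) :
    (1 / 10 ^ 20) ^ n / (4 * 10 ^ 4) * ‖y‖ ^ 2 ≤ ‖⟪(⇑Dc)^[n] y, y⟫_ℂ‖ := by
  obtain ⟨-, hang⟩ := hy
  obtain ⟨h2, -⟩ := apow_bounds ha ha1
  obtain ⟨h4, h6, -⟩ := apow_chain ha ha1
  have hz1 := one_le_norm_zv a hK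
  have hr : ‖zv a K - e 0‖ ≤ 1 / 200 := by
    have h := norm_sq_zv_sub_e0_le a hK
    have h' : ‖zv a K - e 0‖ ^ 2 ≤ (1 / 200) ^ 2 := by nlinarith
    exact le_of_pow_le_pow_left₀ two_ne_zero (by norm_num) h'
  have h1 : (⟪rho a K, y⟫_ℂ).re = ‖zv a K‖⁻¹ * (⟪zv a K, y⟫_ℂ).re := by
    unfold rho; rw [inner_smul_left, Complex.conj_ofReal, Complex.re_ofReal_mul]
  have h3 : ‖⟪zv a K, y⟫_ℂ‖ ≤ ‖y 0‖ + ‖zv a K - e 0‖ * ‖y‖ := by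
    have : ⟪zv a K, y⟫_ℂ = ⟪e 0, y⟫_ℂ + ⟪zv a K - e 0, y⟫_ℂ := by rw [← inner_add_left, add_sub_cancel]
    rw [this, inner_e_left]
    exact (norm_add_le _ _).trans (add_le_add le_rfl (norm_inner_le_norm _ _))
  have h5 : (1 / 100 : ℝ) * ‖y‖ ≤ ‖y 0‖ + 1 / 200 * ‖y‖ := by
    have hre : (⟪zv a K, y⟫_ℂ).re ≤ ‖⟪zv a K, y⟫_ℂ‖ := Complex.re_le_norm _
    have hinv1 : ‖zv a K‖⁻¹ ≤ 1 := inv_le_one_of_one_le₀ hz1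
    have hinv0 : 0 ≤ ‖zv a K‖⁻¹ := inv_nonneg.2 (norm_nonneg _)
    have hn0 : 0 ≤ ‖⟪zv a K, y⟫_ℂ‖ := norm_nonneg _
    have hy4 : ‖zv a K - e 0‖ * ‖y‖ ≤ 1 / 200 * ‖y‖ := mul_le_mul_of_nonneg_right hr (norm_nonneg _)
    rw [h1] at hang
    nlinarith
  have h6' : (1 / 200 : ℝ) * ‖y‖ ≤ ‖y 0‖ := by linarith
  have h7 : ((1 / 200 : ℝ) * ‖y‖) ^ 2 ≤ ‖y 0‖ ^ 2 := pow_le_pow_left₀ (by positivity) h6' 2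
  have hs := summable_wgt_pow_mul_sq n y
  have h8 : wgt 0 ^ n * ‖y 0‖ ^ 2 ≤ ∑' k, wgt k ^ n * ‖y k‖ ^ 2 :=
    hs.le_tsum 0 (fun k _ => by have := wgt_pos k; positivity)
  rw [wgt_zero] at h8
  rw [inner_Dc_iterate, Complex.norm_real, Real.norm_of_nonneg
    (tsum_nonneg (fun k => by have := wgt_pos k; positivity)), ← lam_def]
  have hl : (0 : ℝ) ≤ lam ^ n := pow_nonneg lam_pos_le.1.le n
  calc lam ^ n / (4 * 10 ^ 4) * ‖y‖ ^ 2 = lam ^ n * ((1 / 200 : ℝ) * ‖y‖) ^ 2 := by ring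
    _ ≤ lam ^ n * ‖y 0‖ ^ 2 := mul_le_mul_of_nonneg_left h7 hl
    _ ≤ _ := h8

/-- **`D_c` is of Type 1 via the CYCLIC unit vector `u₀ = ρ`**, `δ_n = 10⁻²⁰ⁿ/(4·10⁴)`, `j = n`. [cite: Enflo2023, v2 p.6, (19)] -/
theorem type1_via_rho {a : ℝ} (ha : 0 < a) (ha1 : a ≤ 1 / 400) {K : ℕ} (hK : 1 ≤ K) : Referee.Type1 Dc :=
  ⟨rho a K, norm_rho a hK, fun n _ => ⟨(1 / 10 ^ 20) ^ n / (4 * 10 ^ 4), by positivity,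
    fun y hy => ⟨n, le_rfl, cone_bound ha ha1 hK n y hy⟩⟩⟩

/-! ### Cyclicity: every coordinate of `ρ`, `u₁`, `x₀ = (√3/2)ρ + ½u₁`, `y₀' = (√3/2)ρ` is non-zero -/

/-- `ρ_k ≠ 0`. [folklore] -/
lemma rho_apply_ne_zero {a : ℝ} (ha : 0 < a) {K : ℕ} (hK : 1 ≤ K) (k : ℕ) : rho a K k ≠ 0 := by
  have hZ : ‖zv a K‖ ≠ 0 := by have := one_le_norm_zv a hK; positivity
  rw [rho_apply]
  exact Complex.ofReal_ne_zero.2 (mul_ne_zero (inv_ne_zero hZ) (pz_pos ha K k).ne')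

/-- `w_k ≠ x̄` for every `k` (`w₀ = 10⁻²⁰ > x̄ > 10⁻²⁰/2 ≥ w_k`, `k ≥ 1`). [folklore] -/
lemma wgt_sub_xbar_ne_zero {a : ℝ} (ha : 0 < a) (ha1 : a ≤ 1 / 400) {K : ℕ} (hK : 1 ≤ K)
    (hKa : 1 / ((K : ℝ) + 1) ≤ a ^ 2) (k : ℕ) : wgt k - xbar a K ≠ 0 := by
  obtain ⟨hx1, hx2⟩ := xbar_bounds ha ha1 hK hKa
  obtain ⟨h2, -⟩ := apow_bounds ha ha1
  have hl := lam_pos_le.1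
  rcases Nat.eq_zero_or_pos k with hk | hk
  · subst hk; rw [wgt_zero]; exact (sub_pos.2 hx2).ne'
  · have hw := wgt_le_half (k := k) hk
    have : wgt k - xbar a K < 0 := by rw [lam_def] at *; nlinarith
    exact this.ne

/-- `(u₁)_k ≠ 0`. [folklore] -/
lemma u1_apply_ne_zero {a : ℝ} (ha : 0 < a) (ha1 : a ≤ 1 / 400) {K : ℕ} (hK : 1 ≤ K)
    (hKa : 1 / ((K : ℝ) + 1) ≤ a ^ 2) (k : ℕ) : u1 a K k ≠ 0 := by
  have hG : ‖gv a K‖ ≠ 0 := (norm_gv_pos ha ha1 hK hKa).ne'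
  rw [u1_apply]
  exact Complex.ofReal_ne_zero.2 (mul_ne_zero (inv_ne_zero hG)
    (mul_ne_zero (wgt_sub_xbar_ne_zero ha ha1 hK hKa k) (pz_pos ha K k).ne'))

/-- `(y₀')_k = (√3/2)ρ_k ≠ 0`. [folklore] -/
lemma yStart_apply_ne_zero {a : ℝ} (ha : 0 < a) {K : ℕ} (hK : 1 ≤ K) (k : ℕ) : yStart (rho a K) k ≠ 0 := by
  unfold yStart
  rw [lp.coeFn_smul, Pi.smul_apply, smul_eq_mul]
  refine mul_ne_zero (Complex.ofReal_ne_zero.2 ?_) (rho_apply_ne_zero ha hK k)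
  have : 0 < Real.sqrt 3 := Real.sqrt_pos.2 (by norm_num)
  positivity

/-- On `k ≥ 1` the `u₁`-component of `x₀` dominates: `2‖g‖ < x̄ − w_k` (`‖g‖ ≤ 1.2·10⁻²⁰a`, `x̄ − w_k ≥ 0.49·10⁻²⁰`).
[folklore] -/
lemma two_norm_gv_lt {a : ℝ} (ha : 0 < a) (ha1 : a ≤ 1 / 400) {K : ℕ} (hK : 1 ≤ K)
    (hKa : 1 / ((K : ℝ) + 1) ≤ a ^ 2) {k : ℕ} (hk : 1 ≤ k) : 2 * ‖gv a K‖ < xbar a K - wgt k := by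
  obtain ⟨hx1, hx2⟩ := xbar_bounds ha ha1 hK hKa
  obtain ⟨hG1, hG2⟩ := norm_sq_gv_bounds ha ha1 hK hKa
  obtain ⟨h2, -⟩ := apow_bounds ha ha1
  obtain ⟨h4, h6, h8⟩ := apow_chain ha ha1
  have hl := lam_pos_le.1
  have hw := wgt_le_half (k := k) hk
  have hb : lam * (1 / 2 - 2 * a ^ 2) ≤ xbar a K - wgt k := by nlinarith
  have hb0 : 0 ≤ lam * (1 / 2 - 2 * a ^ 2) := by nlinarith
  have hsq : (2 * ‖gv a K‖) ^ 2 < (xbar a K - wgt k) ^ 2 := by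
    have h1 : (lam * (1 / 2 - 2 * a ^ 2)) ^ 2 ≤ (xbar a K - wgt k) ^ 2 := pow_le_pow_left₀ hb0 hb 2
    rw [lam_def] at h1 hG2
    nlinarith
  exact lt_of_pow_lt_pow_left₀ 2 (by linarith) hsq

/-- `(x₀)_k = (√3/2)ρ_k + ½(u₁)_k ≠ 0` (positive at `k = 0`, negative for `k ≥ 1`). [folklore] -/
lemma xStart_apply_ne_zero {a : ℝ} (ha : 0 < a) (ha1 : a ≤ 1 / 400) {K : ℕ} (hK : 1 ≤ K)
    (hKa : 1 / ((K : ℝ) + 1) ≤ a ^ 2) (k : ℕ) : xStart (rho a K) (u1 a K) k ≠ 0 := by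
  have hGpos := norm_gv_pos ha ha1 hK hKa
  have hz1 := one_le_norm_zv a hK
  obtain ⟨hx1, hx2⟩ := xbar_bounds ha ha1 hK hKa
  have hx : xStart (rho a K) (u1 a K) k = ((Real.sqrt 3 / 2 * (‖zv a K‖⁻¹ * pz a K k) +
      1 / 2 * (‖gv a K‖⁻¹ * ((wgt k - xbar a K) * pz a K k)) : ℝ) : ℂ) := by
    unfold xStart
    rw [lp.coeFn_add, Pi.add_apply, lp.coeFn_smul, Pi.smul_apply, lp.coeFn_smul, Pi.smul_apply, rho_apply,
      u1_apply, smul_eq_mul, smul_eq_mul]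
    push_cast; ring
  rw [hx, Ne, Complex.ofReal_eq_zero]
  have hp := pz_pos ha K k
  have hzi : 0 < ‖zv a K‖⁻¹ := by positivity
  have hzi1 : ‖zv a K‖⁻¹ ≤ 1 := inv_le_one_of_one_le₀ hz1
  have hgi : 0 < ‖gv a K‖⁻¹ := by positivity
  have hs3 : 0 < Real.sqrt 3 := Real.sqrt_pos.2 (by norm_num)
  have hs3' : Real.sqrt 3 < 2 := (Real.sqrt_lt' (by norm_num)).2 (by norm_num)
  rcases Nat.eq_zero_or_pos k with hk | hk
  · subst hk
    apply ne_of_gt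
    rw [wgt_zero]
    have h0 : 0 < lam - xbar a K := sub_pos.2 hx2
    positivity
  · apply ne_of_lt
    have hkey : 2 < ‖gv a K‖⁻¹ * (xbar a K - wgt k) := by
      have h3 := two_norm_gv_lt ha ha1 hK hKa hk
      have h4 : ‖gv a K‖⁻¹ * (2 * ‖gv a K‖) = 2 := by field_simp
      have := mul_lt_mul_of_pos_left h3 hgi
      linarith
    have hA : Real.sqrt 3 / 2 * ‖zv a K‖⁻¹ < 1 := by nlinarith
    have hB := mul_lt_mul_of_pos_right hA hp
    have hC := mul_lt_mul_of_pos_left hkey (half_pos hp)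
    nlinarith

/-! ### The printed Lemma 1 fails for `(D_c, ρ, u₁)` -/

/-- **The printed Lemma 1 fails for `(D_c, u₀ = ρ, u₁)` with `(εθ)₀ = 2·10⁻²⁰a`, for every `0 < a ≤ 1/400` and every
`K ≥ 1` with `1/(K+1) ≤ a²`.**  `D_c ρ = x̄ρ + σu₁` exactly, `|x̄| ≤ 1`, `(εθ)₀ ≤ 4σ`, and the printed requirement
`‖D_c* u₁‖ < (εθ)₀` holds, so `Lemma1.printed_lemma1_fails_of_lever` gives `εθ(ℓ'_ε) > ½·10⁻⁵(εθ)₀` at EVERY radius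
`ε ∈ (½ − 10⁻⁵(εθ)₀, ½]`. [cite: Enflo2023, v2 p.7 (choice of u₁), pp.8–9 Lemma 1] -/
theorem printed_lemma1_fails_param {a : ℝ} (ha : 0 < a) (ha1 : a ≤ 1 / 400) {K : ℕ} (hK : 1 ≤ K)
    (hKa : 1 / ((K : ℝ) + 1) ≤ a ^ 2) (hT : ‖Dc‖ < 1) :
    ‖adjoint Dc (u1 a K)‖ < 2 * lam * a ∧
    ∀ (ε : ℝ) (b : ℓ2), 1 / 2 - 2 * lam * a / 10 ^ 5 < ε → ε ≤ 1 / 2 →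
      IsMinimal (V Dc hT (yStart (rho a K))) (xStart (rho a K) (u1 a K)) ε b →
      2 * lam * a / (2 * 10 ^ 5) <
        (⟪xStart (rho a K) (u1 a K) - V Dc hT (yStart (rho a K)) b, V Dc hT (yStart (rho a K)) b⟫_ℂ).re := by
  refine ⟨by rw [Dc_isSelfAdjoint.adjoint_eq]; exact norm_Dc_u1_lt ha ha1 hK hKa, ?_⟩
  have he : 0 < 2 * lam * a := by have := lam_pos_le.1; positivity
  have hn₀ : ‖((xbar a K : ℝ) : ℂ)‖ ≤ 1 := by
    obtain ⟨h0, h1⟩ := xbar_nonneg_le_one ha ha1 hK hKa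
    rw [Complex.norm_real, Real.norm_of_nonneg h0]; exact h1
  have hm : 2 * lam * a ≤ 4 * ‖((‖zv a K‖⁻¹ * ‖gv a K‖ : ℝ) : ℂ)‖ := by
    rw [Complex.norm_real, Real.norm_of_nonneg (by positivity)]; exact lever_ge ha ha1 hK hKa
  exact printed_lemma1_fails_of_lever Dc hT norm_Dc_le (rho a K) (u1 a K) (norm_rho a hK)
    (norm_u1 ha ha1 hK hKa) (inner_rho_u1 a hK) _ _ hn₀ (Dc_rho ha ha1 hK hKa) he hm

/-- **Cyclic, regime-faithful Type-1 counter-models to the printed Lemma 1 (packaged).**  Fix the ONE operator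
`T = D_c = diag(10⁻²⁰/(k+1))` on `ℓ²(ℕ)` (standing form of v2 p.1: `‖T‖ = 10⁻²⁰`, injective, dense non-closed range,
`0 ∈ σ(T)`; self-adjoint).  For EVERY `(εθ)₀ ∈ (0, 5·10⁻²³]` there is an orthonormal pair `u₀, u₁` such that
`u₀`, `u₁`, `x₀ = (√3/2)u₀ + ½u₁` and `y₀' = (√3/2)u₀` are all CYCLIC for `T` (orbit closure `= ℓ²`), `T` is of Type 1
via `u₀` with the `(εθ)₀`-INDEPENDENT constants `δ_n = 10⁻²⁰ⁿ/(4·10⁴)` (`j = n` in (19)), the printed choice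
`‖T*u₁‖ < (εθ)₀` (p.7) holds, and the printed conclusion of Lemma 1 (`εθ(ℓ'_ε) ≤ ½·10⁻⁵(εθ)₀` for some
`ε ∈ (½ − 10⁻⁵(εθ)₀, ½]`, pp.8–9) fails at EVERY radius of the window.  So neither taking `(εθ)₀ ≪ δ₁, δ₂, …`
(v2 p.8, p.20) nor insisting that `u₀`, `x₀`, `y₀'` be cyclic (the manuscript's `y` is cyclic) rescues the printed
choice of `u₁`. [cite: Enflo2023, v2 p.1, p.6 (19), p.7 (choice of u₁), p.8, pp.8–9 Lemma 1, p.20] -/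
theorem printed_lemma1_fails_cyclic (e₀ : ℝ) (he : 0 < e₀) (he1 : e₀ ≤ 1 / (2 * 10 ^ 22)) :
    ∃ (u₀ u₁ : ℓ2) (hT : ‖Dc‖ < 1),
      ‖Dc‖ = 1 / 10 ^ 20 ∧ Function.Injective Dc ∧ DenseRange Dc ∧ ¬ Function.Surjective Dc ∧
      (0 : ℂ) ∈ spectrum ℂ Dc ∧ IsSelfAdjoint Dc ∧
      ‖u₀‖ = 1 ∧ ‖u₁‖ = 1 ∧ ⟪u₀, u₁⟫_ℂ = 0 ∧
      orbitClosure Dc u₀ = ⊤ ∧ orbitClosure Dc u₁ = ⊤ ∧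
      orbitClosure Dc (xStart u₀ u₁) = ⊤ ∧ orbitClosure Dc (yStart u₀) = ⊤ ∧
      (∀ n : ℕ, 1 ≤ n → ∀ y : ℓ2, Referee.AngleCond u₀ y →
          (1 / 10 ^ 20) ^ n / (4 * 10 ^ 4) * ‖y‖ ^ 2 ≤ ‖⟪(⇑Dc)^[n] y, y⟫_ℂ‖) ∧
      Referee.Type1 Dc ∧
      ‖adjoint Dc u₁‖ < e₀ ∧
      ∀ (ε : ℝ) (b : ℓ2), 1 / 2 - e₀ / 10 ^ 5 < ε → ε ≤ 1 / 2 →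
        IsMinimal (V Dc hT (yStart u₀)) (xStart u₀ u₁) ε b →
        e₀ / (2 * 10 ^ 5) < (⟪xStart u₀ u₁ - V Dc hT (yStart u₀) b, V Dc hT (yStart u₀) b⟫_ℂ).re := by
  set a : ℝ := e₀ * 10 ^ 20 / 2 with ha_def
  have ha : 0 < a := by positivity
  have ha1 : a ≤ 1 / 400 := by
    rw [ha_def, div_le_iff₀ (by norm_num : (0:ℝ) < 2)]
    have := mul_le_mul_of_nonneg_right he1 (by norm_num : (0:ℝ) ≤ 10 ^ 20)
    norm_num at this ⊢
    linarith
  have hK := one_le_Kof ha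
  have hKa := inv_Kof_succ_le ha
  have hae : 2 * lam * a = e₀ := by rw [lam_def, ha_def]; ring
  obtain ⟨hadj, hfail⟩ := printed_lemma1_fails_param ha ha1 hK hKa norm_Dc_lt_one
  rw [hae] at hadj hfail
  exact ⟨rho a (Kof a), u1 a (Kof a), norm_Dc_lt_one, norm_Dc, Dc_injective, Dc_denseRange, Dc_not_surjective,
    zero_mem_spectrum_Dc, Dc_isSelfAdjoint, norm_rho a hK, norm_u1 ha ha1 hK hKa, inner_rho_u1 a hK,
    orbitClosure_eq_top _ (rho_apply_ne_zero ha hK), orbitClosure_eq_top _ (u1_apply_ne_zero ha ha1 hK hKa),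
    orbitClosure_eq_top _ (xStart_apply_ne_zero ha ha1 hK hKa),
    orbitClosure_eq_top _ (yStart_apply_ne_zero ha hK),
    fun n _ y hy => cone_bound ha ha1 hK n y hy, type1_via_rho ha ha1 hK, hadj, hfail⟩

/-- **A cyclic regime-faithful instance: `(εθ)₀ = 10⁻⁶⁰`.**  `T = D_c`, `u₀, u₁, x₀, y₀'` cyclic, `δ₁ = 2.5·10⁻²⁵` and
`δ₂ = 2.5·10⁻⁴⁵` exceed `(εθ)₀ = 10⁻⁶⁰` by dozens of orders of magnitude (v2 p.8 / p.20), `‖T*u₁‖ < (εθ)₀`, and the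
printed conclusion of Lemma 1 fails at every radius of `(½ − 10⁻⁶⁵, ½]`. [cite: Enflo2023, v2 p.8, pp.8–9 Lemma 1, p.20] -/
theorem printed_lemma1_fails_cyclic_instance :
    ∃ (u₀ u₁ : ℓ2) (hT : ‖Dc‖ < 1),
      ‖Dc‖ = 1 / 10 ^ 20 ∧ Function.Injective Dc ∧ DenseRange Dc ∧ ¬ Function.Surjective Dc ∧
      ‖u₀‖ = 1 ∧ ‖u₁‖ = 1 ∧ ⟪u₀, u₁⟫_ℂ = 0 ∧
      orbitClosure Dc u₀ = ⊤ ∧ orbitClosure Dc u₁ = ⊤ ∧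
      orbitClosure Dc (xStart u₀ u₁) = ⊤ ∧ orbitClosure Dc (yStart u₀) = ⊤ ∧
      (∀ y : ℓ2, Referee.AngleCond u₀ y → 25 / 10 ^ 26 * ‖y‖ ^ 2 ≤ ‖⟪(⇑Dc)^[1] y, y⟫_ℂ‖) ∧
      (∀ y : ℓ2, Referee.AngleCond u₀ y → 25 / 10 ^ 46 * ‖y‖ ^ 2 ≤ ‖⟪(⇑Dc)^[2] y, y⟫_ℂ‖) ∧
      ‖adjoint Dc u₁‖ < 1 / 10 ^ 60 ∧
      ∀ (ε : ℝ) (b : ℓ2), 1 / 2 - (1 / 10 ^ 60) / 10 ^ 5 < ε → ε ≤ 1 / 2 →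
        IsMinimal (V Dc hT (yStart u₀)) (xStart u₀ u₁) ε b →
        (1 / 10 ^ 60) / (2 * 10 ^ 5) < (⟪xStart u₀ u₁ - V Dc hT (yStart u₀) b, V Dc hT (yStart u₀) b⟫_ℂ).re := by
  obtain ⟨u₀, u₁, hT, h1, h2, h3, h4, -, -, h7, h8, h9, h10, h11, h12, h13, h14, -, h16, h17⟩ :=
    printed_lemma1_fails_cyclic (1 / 10 ^ 60) (by norm_num) (by norm_num)
  refine ⟨u₀, u₁, hT, h1, h2, h3, h4, h7, h8, h9, h10, h11, h12, h13, fun y hy => ?_, fun y hy => ?_, h16, h17⟩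
  · have := h14 1 le_rfl y hy
    norm_num at this ⊢
    linarith
  · have := h14 2 (by norm_num) y hy
    norm_num at this ⊢
    linarith

end Cyclic

end Lemma1

end Literature.Analysis.OperatorTheory.Enflo2023
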